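import Literature.Topology.FourManifolds.ConnectedSum
import Literature.Topology.FourManifolds.ConnectedSumData
import Literature.Topology.FourManifolds.GluingConstruction
import HarnessLib

/-!
# Existence of connected sums (proof of `Literature.Topology.FourManifolds.exists_isConnectedSum`)

This file discharges the named fact `Literature.Topology.FourManifolds.exists_isConnectedSum` of
`Literature.Topology.FourManifolds.ConnectedSum`: two nonempty closed smooth `n`-manifolds `M`, `N`
have a connected sum, i.e. there is a closed smooth `n`-manifold `P` with
`IsConnectedSum (𝓡 n) (𝓡 n) (𝓡 n) M N P` (Kervaire–Milnor, *Groups of homotopy spheres I*,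
Ann. of Math. 77 (1963), §2, p. 505; Kosinski, *Differential Manifolds* (1993), Ch. VI §1,
Theorem (1.1): "`M₁ # M₂` is a smooth manifold, connected if `m > 1` and oriented if both `M₁`,
`M₂` are oriented").

The proof assembles the data of `Literature.Topology.FourManifolds.ConnectedSumData` (discs
`i₁ = e₁.symm`, `i₂ = e₂.symm` from charts onto `ℝⁿ`; the gluing map `φ` between the punctured
pieces `M ∖ {i₁ 0}`, `N ∖ {i₂ 0}`, which is Kervaire–Milnor's identification
`i₁ (t • u) ∼ i₂ ((1 - t) • u)`; closedness of its graph; the compact pieces `K₁ = M ∖ i₁ (ball 0 ½)`,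
`K₂ = N ∖ i₂ (ball 0 ½)`) with the pushout `Literature.Topology.FourManifolds.SmoothGlueData.Glued` of
`Literature.Topology.FourManifolds.GluingConstruction`.

* In positive dimension, `P` is the glued space of the datum `⟨φ, _, _, id, id⟩`: a smooth
  `n`-manifold in which the two punctured pieces are open smooth embeddings intersecting along
  Kervaire–Milnor's relation (`SmoothGlueData.isOpenGluing`); Hausdorff because the graph of `φ`
  is closed (Kosinski's proof of (1.1): the centres of the discs are removed); compact because it
  is covered by the images of `K₁` and `K₂` — a point of the small punctured disc
  `i₁ (ball 0 ½ ∖ 0)` is glued to a point outside `i₂ (ball 0 ½)` since `‖ψ v‖ = 1 - ‖v‖`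
  (`Literature.Topology.FourManifolds.ConnectedSumData.φ_mem_K₂`); second countable as a compact charted space.
* In dimension `0` there are no unit vectors, the relation is empty, and `P` is the disjoint
  union `(M ∖ {x}) ⊕ (N ∖ {y})` with Mathlib's manifold structure on a sum; the pieces are compact
  because points of `0`-manifolds are open.
-/

open scoped Manifold ContDiff Topology
open Set Function Metric Module OpenPartialHomeomorph Topology

noncomputable section

namespace Literature.Topology.FourManifolds

universe u v

section Construction

variable {n : ℕ} {M : Type u} {N : Type v} [TopologicalSpace M] [T2Space M]
  [ChartedSpace (EuclideanSpace ℝ (Fin n)) M] [TopologicalSpace N] [T2Space N]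
  [ChartedSpace (EuclideanSpace ℝ (Fin n)) N]

namespace ConnectedSumData

variable (D : ConnectedSumData n M N) (hn : n ≠ 0)

/-! #### The cover `M # N = (M ∖ i₁ B_½) ∪ (N ∖ i₂ B_½)` -/

/-- A point of the first punctured piece outside `K₁ = M ∖ i₁ (ball 0 ½)`, i.e. a point of the
small punctured disc `i₁ (ball 0 ½ ∖ 0)`, is glued to a point of `K₂ = N ∖ i₂ (ball 0 ½)`, since
`‖ψ v‖ = 1 - ‖v‖` (Kervaire–Milnor 1963, §2: `M # N` is covered by the images of the two
complements of half-discs, hence compact). [cite: KervaireMilnor1963, §2] -/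
theorem φ_mem_K₂ {a : D.A} (ha : a ∉ D.K₁) : a ∈ (D.φ hn).source ∧ D.φ hn a ∈ D.K₂ := by
  simp only [K₁, mem_preimage, mem_compl_iff, not_not] at ha
  obtain ⟨h₁, h₂⟩ := ha
  rw [mem_preimage, mem_ball_zero_iff] at h₂
  have hv0 : D.e₁ a ≠ 0 := fun h0 => a.2 (by
    rw [mem_singleton_iff, ← D.i₁_e₁ h₁, h0])
  have hlt : ‖D.e₁ a‖ < 1 := h₂.trans (by norm_num)
  have ha : a ∈ (D.φ hn).source :=
    (D.mem_φ_source hn).2 (D.mem_Φ_source.2 ⟨h₁, norm_pos_iff.2 hv0, hlt⟩)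
  refine ⟨ha, ?_⟩
  rintro ⟨-, hb⟩
  rw [mem_preimage, D.coe_φ hn ha, Φ_apply, D.e₂_i₂, mem_ball_zero_iff,
    norm_discInversionFun hv0 hlt.le] at hb
  linarith

/-- Symmetrically, a point of the second punctured piece outside `K₂` is glued (by `φ.symm`) to a
point of `K₁` (Kervaire–Milnor 1963, §2). [cite: KervaireMilnor1963, §2] -/
theorem φ_symm_mem_K₁ {b : D.B} (hb : b ∉ D.K₂) :
    b ∈ (D.φ hn).target ∧ (D.φ hn).symm b ∈ D.K₁ := by
  simp only [K₂, mem_preimage, mem_compl_iff, not_not] at hb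
  obtain ⟨h₁, h₂⟩ := hb
  rw [mem_preimage, mem_ball_zero_iff] at h₂
  have hv0 : D.e₂ b ≠ 0 := fun h0 => b.2 (by
    rw [mem_singleton_iff, ← D.i₂_e₂ h₁, h0])
  have hlt : ‖D.e₂ b‖ < 1 := h₂.trans (by norm_num)
  have hb : b ∈ (D.φ hn).target :=
    (D.mem_φ_target hn).2 (D.mem_Φ_target.2 ⟨h₁, norm_pos_iff.2 hv0, hlt⟩)
  refine ⟨hb, ?_⟩
  rintro ⟨-, ha⟩
  rw [mem_preimage, D.coe_φ_symm hn hb, Φ_symm_apply, D.e₁_i₁, mem_ball_zero_iff,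
    norm_discInversionFun hv0 hlt.le] at ha
  linarith

/-! #### Assembly -/

variable [IsManifold (𝓡 n) ∞ M] [IsManifold (𝓡 n) ∞ N]

include D hn in
/-- **Existence of connected sums in positive dimension.** The glued space of the punctured
pieces `M ∖ {i₁ 0}`, `N ∖ {i₂ 0}` of two closed smooth `n`-manifolds, `n ≠ 0`, along the gluing
map `φ` (the smooth gluing datum `⟨φ, _, _, id, id⟩` of `Literature.Topology.FourManifolds.SmoothGlueData`) is a closed smooth
`n`-manifold which is a connected sum `M # N` with discs `i₁`, `i₂` (Kervaire–Milnor 1963, §2;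
Kosinski, *Differential Manifolds*, VI.1, Theorem (1.1)). [cite: Kosinski1993, Ch. VI §1, Thm (1.1)] -/
theorem exists_isConnectedSum_of_ne_zero [CompactSpace M] [CompactSpace N] :
    ∃ (P : Type (max u v)) (_ : TopologicalSpace P) (_ : T2Space P) (_ : SecondCountableTopology P)
      (_ : ChartedSpace (EuclideanSpace ℝ (Fin n)) P) (_ : IsManifold (𝓡 n) ∞ P) (_ : CompactSpace P),
      IsConnectedSum (𝓡 n) (𝓡 n) (𝓡 n) M N P := by
  let d : SmoothGlueData (𝓡 n) (𝓡 n) D.A D.B (EuclideanSpace ℝ (Fin n)) :=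
    ⟨D.φ hn, D.contMDiffOn_φ hn, D.contMDiffOn_φ_symm hn, ContinuousLinearEquiv.refl ℝ _,
      ContinuousLinearEquiv.refl ℝ _⟩
  haveI : T2Space d.Glued := d.t2Space_of_isClosed_graph (D.isClosed_graph_φ hn)
  haveI : CompactSpace d.Glued :=
    d.compactSpace_of_forall_not_mem D.isCompact_K₁ D.isCompact_K₂ (fun _ ha => D.φ_mem_K₂ hn ha)
      fun _ hb => D.φ_symm_mem_K₁ hn hb
  haveI : SecondCountableTopology d.Glued := d.secondCountableTopology
  exact ⟨d.Glued, inferInstance, inferInstance, inferInstance, inferInstance, inferInstance,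
    inferInstance, D.i₁, D.i₂, D.isSmoothEmbedding_i₁, D.isSmoothEmbedding_i₂,
    d.isOpenGluing (D.connectedSumRel_iff_φ hn)⟩

/-! #### Dimension zero -/

include D in
/-- **Existence of connected sums in dimension `0`**: there are no unit vectors in `ℝ⁰`, so
Kervaire–Milnor's relation is empty and `M # N = (M ∖ {i₁ 0}) ⊕ (N ∖ {i₂ 0})` with the
disjoint-union manifold structure; the pieces are compact because points of `0`-manifolds are
open (Kervaire–Milnor 1963, §2). [cite: KervaireMilnor1963, §2] -/
theorem exists_isConnectedSum_of_eq_zero (h0 : n = 0) [SecondCountableTopology M] [CompactSpace M]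
    [SecondCountableTopology N] [CompactSpace N] :
    ∃ (P : Type (max u v)) (_ : TopologicalSpace P) (_ : T2Space P) (_ : SecondCountableTopology P)
      (_ : ChartedSpace (EuclideanSpace ℝ (Fin n)) P) (_ : IsManifold (𝓡 n) ∞ P) (_ : CompactSpace P),
      IsConnectedSum (𝓡 n) (𝓡 n) (𝓡 n) M N P := by
  haveI : CompactSpace D.A := isCompact_iff_compactSpace.1
    (isOpen_singleton_of_chartedSpace_zero h0 (D.i₁ 0)).isClosed_compl.isCompact
  haveI : CompactSpace D.B := isCompact_iff_compactSpace.1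
    (isOpen_singleton_of_chartedSpace_zero h0 (D.i₂ 0)).isClosed_compl.isCompact
  refine ⟨D.A ⊕ D.B, inferInstance, inferInstance, inferInstance, inferInstance, inferInstance,
    inferInstance, D.i₁, D.i₂, D.isSmoothEmbedding_i₁, D.isSmoothEmbedding_i₂, Sum.inl, Sum.inr,
    Manifold.IsSmoothEmbedding.sumInl, isOpen_range_inl, Manifold.IsSmoothEmbedding.sumInr,
    isOpen_range_inr, range_inl_union_range_inr, fun a b => iff_of_false Sum.inl_ne_inr ?_⟩
  subst h0
  rintro ⟨u, t, hu, -⟩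
  have : ‖u‖ = 0 := by simp [EuclideanSpace.norm_eq]
  exact zero_ne_one (this.symm.trans hu)

end ConnectedSumData

end Construction

/-- **Existence of connected sums** (Kervaire–Milnor, *Groups of homotopy spheres I* (1963), §2;
Kosinski, *Differential Manifolds* (1993), Ch. VI §1): discharge of the named fact
`Literature.Topology.FourManifolds.exists_isConnectedSum`. Two nonempty closed smooth `n`-manifolds have a connected sum which
is a closed smooth `n`-manifold: the pushout of the punctured manifolds along Kervaire–Milnor's
identification of punctured coordinate discs (the disjoint union if `n = 0`). Kosinski's
Theorem VI.(1.1) reads: "`M₁ # M₂` is a smooth manifold, connected if `m > 1` and oriented if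
both `M₁`, `M₂` are oriented"; compactness of `M₁ # M₂` for closed `Mᵢ` is used tacitly there
(VI.2, (2.2): closed manifolds form a monoid under `#`). Nonemptiness of `M`, `N` provides the
charts (`Literature.Topology.FourManifolds.nonempty_connectedSumData`). [cite: Kosinski1993, Ch. VI §1, Thm (1.1)] -/
theorem exists_isConnectedSum_holds {n : ℕ} : exists_isConnectedSum.{u} (n := n) := by
  intro M N _ _ _ _ _ _ _ _ _ _ _ _ _ _
  obtain ⟨D⟩ := nonempty_connectedSumData (n := n) (M := M) (N := N)
  rcases eq_or_ne n 0 with hn | hn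
  · exact D.exists_isConnectedSum_of_eq_zero hn
  · exact D.exists_isConnectedSum_of_ne_zero hn

end Literature.Topology.FourManifolds
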